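import Summits.AtomisticToContinuum.HydrodynamicLimit.Theses.AntiMazurCoboundaries
import Summits.AtomisticToContinuum.HydrodynamicLimit.Theses.FluxGibbsianityLdDrude
import Summits.AtomisticToContinuum.HydrodynamicLimit.Theses.CollisionIsometryCLT
import Literature.Barriers.AtomisticToContinuum.HighMomentumCutoff
import Literature.Barriers.AtomisticToContinuum.HighMomentumCutoffNarrow

/-!
# Line `self-similar-block-periodisation` — CHECKED SKELETON for crux `KineticWindowGronwall`
(stmt-AtomisticToContinuum-9282; routes AntiMazurCoboundaries (primary) + FluxGibbsianityLdDrude, `rfl`-equal decls)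

Crux (FIXED): `KineticWindowGronwall := KineticFluxLdDecay → RelEntropyVanishing` ("B from A", Disproof §1).

Idea card `Cruxes/KineticWindowGronwall/Ideas/self-similar-block-periodisation.md` (ideator 2, r1; triage r1: 3× pass,
merge-base with dlr-block-transfer / locality-inside-the-pressure).  The card is the LOCALISATION child of "B from A":
fixed-reduced-density hard spheres are exactly self-similar under block periodisation (`hsDiameter σ n = m · hsDiameter σ N`
for `N+1 = m³(n+1)`), so a periodised, collar-thinned mesoscopic block IS an instance of the homogeneous hypothesis at
`(n_b, σρ̂_b^{1/3}, u_b, θ_b)`; 27-colour chessboard Hölder + exact hard-core Markov factorisation + canonical↔grand-canonical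
at LD precision factorise the per-window pressure; the ONLY dynamical input left is influence locality across a MACROSCOPIC
collar within ONE kinetic window (triage X1: the per-window pressure carries the weight `h`, Disproof §5.5
`discreteWindowGronwall_exp`, so every `o(N) + C·N·(r² + η)` overhead per window is harmless).

Because the crux is the bare implication A → B, a concluding skeleton must ALSO carry the inputs of "B from A" that are not
this line's (triage X2/BN1 amplitude budget, X3/N4 dilute guard, collisional twin, velocity tails, statics).  They are
isolated below as NAMED stubs over EXISTING board decls, so that the line's own stubs (`stub_shortWindowLocality`,
`stub_blockPeriodisation`) are exactly the card's lever and nothing is hidden in an unnamed step: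

* `stub_amplitudeUpgrade : KineticFluxLdDecay → KineticFluxLdDecayQuad` — the crux's TYPING GAP (triage X2 = ideator-3 BN1:
  with `|g| ≤ κ` the truncated heat flux enters the entropy inequality at amplitude `≤ 2κ/(c_θA³)`, Gronwall rate `∝ A³`,
  nothing beats it; BN3/S2: blockwise use consumes A on a continuum of reduced densities, so `κ` must be uniform in `σ`).
  NOT this line's lever; it is `id`-like once tenure re-types 10967 as requested (IdeatorThreeBarrierNotes BN1/BN3), and its
  quadratic half is the target of the sibling crux idea `rare-band-residence-ladder` (RareBandSlaving + AmplitudeLadder).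
* `stub_shortWindowLocality : ShortWindowInfluenceLocality` — THE LINE'S ONE DYNAMICAL LEMMA: 13916's statement in its easy
  regime (horizon one kinetic window `τℓ`, range a FIXED macroscopic `R₀`, `∀ lam` superexponential form).
* `stub_blockPeriodisation : KineticFluxLdDecayQuad → ShortWindowInfluenceLocality → LocalQuadLd` — THE LEVER (card steps
  (1)–(3) + triage sharpenings): block-freezing (Rényi `O(N r²)`), side-rounded periodisation + `ε_N`-collar thinning
  (static `e^{±o(n_b)}`/`e^{Cηn_b}` comparisons uniform in the exterior), 27-colour chessboard, hard-core Markov property,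
  ensemble equivalence, `ψ_t ≤ e^{KN} G_hot` domination for the locality bad set (no reference is transported: triage r1-3 (a)),
  exact Galilean/thermal covariance + window upward-stability, and the verbatim instance of the hypothesis per block.
* `stub_windowGronwall : LocalQuadLd → (9518 ∧ 9519) → GaussianTailsAlongEvolution → (9246 ∧ 0768) → 3091 → RelEntropyVanishing`
  — the kinetic-window relative-entropy LEDGER (Yau / Nachtergaele–Yau bookkeeping with `M = A`, Osgood variant BN4),
  anchored at `H(f₀|ψ₀) = 0` for the TIED datum (Disproof §2) and consuming the Euler balance laws (Disproof §3).
* `stub_trueLawInputs`, `stub_staticAndPdeInputs` — the GIVEN children of 9282 that are other items on the board: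
  `CollisionIsometryCLT.CollisionalTransferLocality` (9518) ∧ `.AprioriBounds` (9519); `∃σ₀ ∀σ<σ₀, HighMomentumCutoff σ`
  (catalogued open hypothesis, `Literature.Barriers.AtomisticToContinuum.HighMomentumCutoff`);
  `FluxGibbsianityLdDrude.LocalGibbsConcentration` (9246) ∧ `.HsEosLowDensity` (0768); `CollisionIsometryCLT.DiluteSelfConsistency` (3091).

`KineticWindowGronwall_of` (primary route's decl) / `KineticWindowGronwall_of_sibling` (FluxGibbsianityLdDrude's, `rfl`-equal)
compose the six stub STATEMENTS — named Props `AmplitudeUpgrade`, `ShortWindowInfluenceLocality`, `BlockPeriodisation`,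
`WindowGronwall`, `TrueLawInputs`, `StaticAndPdeInputs`, aliased `Registered.stub_*` — into the crux BY NAME (pure logic, no sorry).

Disproof.lean (cdisprove cycle 1, v5) honoured: §2 tie (the ledger stub concludes the TIED `RelEntropyVanishing`; the landed
`KineticWindowGronwallNegative.crux_untied_false_of_antecedent`, see §4), §3 balance laws (consumed through
`IsHardSphereEulerSolution` inside B and 3091), §4 cubic moments (`lintegral_exp_mul_pow_three_eq_top`, landed; barrier form `setLIntegral_exp_cubic_eq_top` re-checked in §4): nothing cubic
is ever exponentiated — every LD statement below is in the quadratic-growth class, finite by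
`Literature.Barriers.AtomisticToContinuum.lintegral_exp_quadratic_lt_top`; the cubic tail is paid in EXPECTATION by
`HighMomentumCutoff` (stub_trueLawInputs), §5.5 bookkeeping = the shape of `stub_windowGronwall`.
Negatives index: none of the 12 refuted statements is a stub or an instance of one (14607's cubic exponential budget avoided).
-/

noncomputable section

namespace Summit.AtomisticToContinuum.HydrodynamicLimit.Cruxes.KineticWindowGronwall.SelfSimilarBlockPeriodisation

open scoped BigOperators ENNReal Classical
open MeasureTheory Set
open Literature.MathematicalPhysics.KineticTheory Literature.Analysis.FluidPDE
open Summit.AtomisticToContinuum.HydrodynamicLimit.Theses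
open Summit.AtomisticToContinuum.HydrodynamicLimit.Theses.AntiMazurCoboundaries

/-! ## §0 Sanity: the crux and the shared decls -/

/-- The crux is literally `A → B`. -/
example : KineticWindowGronwall = (KineticFluxLdDecay → RelEntropyVanishing) := rfl

/-- The consequent is the sibling route's target verbatim (items 0766 shared). -/
example : AntiMazurCoboundaries.RelEntropyVanishing = FluxGibbsianityLdDrude.RelEntropyVanishing := rfl

/-! ## §1 The typed statements of the line -/

/-- **Block self-similarity of fixed-reduced-density hard spheres** (the card's first lemma, re-proved here so the
skeleton is self-contained): if `N + 1 = m³ (n + 1)` then the physical diameter of the `(n+1)`-sphere system at reduced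
parameter `σ` is `m` times that of the `(N+1)`-sphere system — a sub-cube of side `1/m`, periodised and blown up by `m`,
is the hypothesis' own system at the SAME `σ`. [folklore] -/
theorem hsDiameter_block (σ : ℝ) {m n N : ℕ} (hm : 0 < m) (h : N + 1 = m ^ 3 * (n + 1)) :
    hsDiameter σ n = (m : ℝ) * hsDiameter σ N := by
  unfold hsDiameter
  have hm' : (0 : ℝ) < m := by exact_mod_cast hm
  have hn' : (0 : ℝ) < ((n + 1 : ℕ) : ℝ) := by positivity
  have hcast : ((N + 1 : ℕ) : ℝ) = (m : ℝ) ^ 3 * ((n + 1 : ℕ) : ℝ) := by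
    have := congrArg (fun k : ℕ => (k : ℝ)) h
    simpa using this
  rw [hcast, Real.mul_rpow (by positivity) hn'.le]
  have h3 : ((m : ℝ) ^ 3) ^ (-(1 / 3 : ℝ)) = (m : ℝ)⁻¹ := by
    rw [← Real.rpow_natCast, ← Real.rpow_mul hm'.le]
    norm_num
    exact Real.rpow_neg_one (m : ℝ)
  rw [h3]
  field_simp

/-- **The re-typed hypothesis (quadratic-growth class, `κ` before `σ`)** — verbatim the shape of ideator 3's
`IdeatorThree.KineticFluxLdDecayQuad` (IdeatorThreeSketch.lean, rc 0; copied, not imported, to keep this skeleton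
independent of a mutable workfile).  Same frame as `KineticFluxLdDecay` (constant profiles `(a, u₀, θ)`, global Gibbs
`G_N = localGibbsLaw σ a u₀ θ`, every hard-sphere flow, kinetic window `h = τ (N+1)^{-1/3}`), but the fast observable may
grow quadratically, `|g(w)| ≤ κ (1 + ‖w‖²)`, and `κ` is chosen BEFORE `σ` (`∃ σ₀ ∃ κ ∀ σ < σ₀`).  The truncated heat flux
`w(‖w‖² − 5)/2 · χ(‖w‖ ≤ A)` divided by `A` lies in this class with an `A`-independent constant, which is what makes the
kinetic-window Gronwall close (Nachtergaele–Yau rate `δ⁻¹M`).  Exponential moments are finite for each `N` (kinetic energy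
conserved; `lintegral_exp_quadratic_lt_top`). -/
def KineticFluxLdDecayQuad : Prop :=
  ∀ (a θ : ℝ) (u₀ : V3), 0 < a → 0 < θ → ∃ σ₀ : ℝ, 0 < σ₀ ∧ ∃ κ : ℝ, 0 < κ ∧ ∀ σ : ℝ, 0 < σ → σ < σ₀ →
    (∀ (N : ℕ) (Φ : HardSphereFlow (Torus.geometry (Fin 3)) (hsDiameter σ N) (N + 1)),
      IsProbabilityMeasure (localGibbsLaw σ (fun _ => a) (fun _ => u₀) (fun _ => θ) N Φ)) ∧
    ∀ (φ : T3 → ℝ) (g : V3 → ℝ), Continuous φ → Continuous g → (∀ x, |φ x| ≤ 1) →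
      (∀ v, |g v| ≤ κ * (1 + ‖v‖ ^ 2)) →
      (∀ (c₀ c₂ : ℝ) (b : V3), ∫ v, g v * (c₀ + inner ℝ b v + c₂ * ‖v‖ ^ 2) ∂(ProbabilityTheory.stdGaussian V3) = 0) →
      ∀ δ : ℝ, 0 < δ → ∃ τ : ℝ, 0 < τ ∧ ∃ N₀ : ℕ, ∀ N : ℕ, N₀ ≤ N →
        ∀ Φ : HardSphereFlow (Torus.geometry (Fin 3)) (hsDiameter σ N) (N + 1),
          ∫⁻ z, ENNReal.ofReal (Real.exp ((τ * ((N + 1 : ℕ) : ℝ) ^ (-(1 / 3 : ℝ)))⁻¹ *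
              ∫ s in (0 : ℝ)..(τ * ((N + 1 : ℕ) : ℝ) ^ (-(1 / 3 : ℝ))),
                ∑ i, φ (Φ.flow s z i).1 * g ((Real.sqrt θ)⁻¹ • ((Φ.flow s z i).2 - u₀))))
            ∂(localGibbsLaw σ (fun _ => a) (fun _ => u₀) (fun _ => θ) N Φ) ≤
          ENNReal.ofReal (Real.exp (δ * (N + 1)))

/-- The kinetic window is self-similar in the same way: `τ (n+1)^{-1/3} = m · τ (N+1)^{-1/3}` for `N + 1 = m³(n + 1)`
(time is blown up by `m` together with space; velocities are unchanged). [folklore] -/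
theorem kineticWindow_block (τ : ℝ) {m n N : ℕ} (hm : 0 < m) (h : N + 1 = m ^ 3 * (n + 1)) :
    τ * ((n + 1 : ℕ) : ℝ) ^ (-(1 / 3 : ℝ)) = (m : ℝ) * (τ * ((N + 1 : ℕ) : ℝ) ^ (-(1 / 3 : ℝ))) :=
  hsDiameter_block τ hm h

/-- **The upgrade is a genuine strengthening**: the re-typed hypothesis implies the typed one (take the same `σ₀`, the same
`κ`, and `κ ≤ κ(1 + ‖v‖²)`).  So `stub_amplitudeUpgrade` asks for `A → A⁺` with `A⁺ → A` proved here. [folklore] -/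
theorem typed_of_quad : KineticFluxLdDecayQuad → KineticFluxLdDecay := by
  intro hQ a θ u₀ ha hθ
  obtain ⟨σ₀, hσ₀, κ, hκ, H⟩ := hQ a θ u₀ ha hθ
  refine ⟨σ₀, hσ₀, fun σ hσ hσlt => ⟨(H σ hσ hσlt).1, κ, hκ, ?_⟩⟩
  intro φ g hφ hg hφ1 hgκ horth δ hδ
  refine (H σ hσ hσlt).2 φ g hφ hg hφ1 (fun v => (hgκ v).trans ?_) horth δ hδ
  have h1 : (1 : ℝ) ≤ 1 + ‖v‖ ^ 2 := le_add_of_nonneg_right (sq_nonneg _)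
  simpa using mul_le_mul_of_nonneg_left h1 hκ.le

/-- **SHORT-WINDOW, MACROSCOPIC-COLLAR INFLUENCE LOCALITY** (the line's one dynamical lemma; the "easy regime" of the
AntiMazur crux `InfluenceLocality` 13916 isolated by triage X1).  Setting of 13916 (homogeneous invariant Gibbs law
`G_N = localGibbsLaw σ a u₀ θ`, `N+1` spheres of diameter `σℓ`, `ℓ = (N+1)^{-1/3}`; particle `i` is BAD on `[0, τℓ]` if
its true state differs at some time from its LOCAL FORECAST `localClusterState Ψ R₀ t z i`, the isolated evolution of the
particles initially within torus distance `R₀` of `x_i`).  Differences from 13916: the horizon is ONE kinetic window `τℓ`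
(macroscopically vanishing) and the range is a FIXED MACROSCOPIC `R₀ > 0` (so `R₀/ℓ → ∞` kinetic units), quantified `∀ R₀`
instead of `∃ R`.  CLAIM: `∀ τ lam δ R₀ > 0 ∃ N₀ ∀ N ≥ N₀ ∀ Φ Ψ: ∫ exp(lam · #{bad i}) dG_N ≤ e^{δ(N+1)}`.
Content (triage r1-2 A2 / r1-1): crossing `R₀` within `τℓ` needs a carrier of speed `≍ R₀/(τℓ)` (Gaussian cost `≍ N^{2/3}`
per carrier, corrupting `O(N^{1/3})` forecasts), a Newton-cradle chain of `≍ R₀/(σℓ)` near-contacts (cost `≍ log N` per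
corrupted forecast), or a near-jammed cluster of diameter `R₀` (cost `≍ log(R₀/τℓ)` per member): the cost per bad particle
diverges, which is exactly the `∀ lam` form.  Not implied formally by 13916 (bad sets are not monotone in the range). -/
def ShortWindowInfluenceLocality : Prop :=
  ∀ (a θ : ℝ) (u₀ : V3), 0 < a → 0 < θ → ∃ σ₀ : ℝ, 0 < σ₀ ∧ ∀ σ : ℝ, 0 < σ → σ < σ₀ →
    ∀ (τ lam δ R₀ : ℝ), 0 < τ → 0 < lam → 0 < δ → 0 < R₀ → ∃ N₀ : ℕ, ∀ N : ℕ, N₀ ≤ N →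
      ∀ (Φ : HardSphereFlow (Torus.geometry (Fin 3)) (hsDiameter σ N) (N + 1))
        (Ψ : (k : ℕ) → HardSphereFlow (Torus.geometry (Fin 3)) (hsDiameter σ N) k),
        ∫⁻ z, ENNReal.ofReal (Real.exp (lam *
            ((Finset.univ.filter fun i : Fin (N + 1) =>
                ∃ t ∈ Set.Icc (0 : ℝ) (τ * ((N + 1 : ℕ) : ℝ) ^ (-(1 / 3 : ℝ))),
                  Φ.flow t z i ≠ localClusterState Ψ R₀ t z i).card : ℝ)))
          ∂(localGibbsLaw σ (fun _ => a) (fun _ => u₀) (fun _ => θ) N Φ) ≤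
        ENNReal.ofReal (Real.exp (δ * (N + 1)))

/-- **THE LOCALISED WINDOW PRESSURE (output of the lever; the card's "PATCHWORK transfer C⁺" in quadratic dress and in
the quantifier order the target needs).**  There are a REDUCED-DENSITY THRESHOLD `η₁ > 0` and an AMPLITUDE `κ₁ > 0`,
universal, such that for EVERY `σ > 0`, every jointly continuous profile family `(a_t, u_t, θ_t)` on `ℝ × 𝕋³`
(`a, θ > 0`; think: the local Gibbs reference driven by the Euler solution, extended constantly outside `[0,T]`), every
horizon `T`, under the DENSITY GUARD `σ³ · a_t(x) ≤ η₁ · ∫ a_t` on `[0,T]` (scale-invariant in `a`, as it must be: the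
canonical law `localGibbsLaw` ignores constant factors of the activity; for the dilute hard-core gas the one-body density
of the reference is `≤ (a/∫a)·e^{O(η₁)}`, so the guard puts every block in the band where the hypothesis applies), for every
time-dependent continuous test function `|φ_t| ≤ 1`, every continuous `g` of the quadratic class `|g(w)| ≤ κ₁(1 + ‖w‖²)`
orthogonal to `span(1, v, ‖v‖²)` in `L²(stdGaussian)`, and every `δ > 0`, there are ONE window `τ` and ONE `N₀` serving all
`t ∈ [0,T]`: the kinetic-window exponential moment of `Σ_i φ_t(x_i(s)) g((v_i(s) − u_t(x_i(s)))/√θ_t(x_i(s)))`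
(standardised in the LOCAL frame) under `localGibbsLaw σ (a t) (u t) (θ t)` is `≤ e^{δ(N+1)}`.  This is the crux
docstring's "log ∫ e^{βX} dψ_t ≤ N(Λ_τ + o(1)) after LOCALISING", made a Prop (cf. ideator 3's `LocalKineticFluxLd`,
which puts `∃σ₀` AFTER the profile family and therefore cannot be plugged into `RelEntropyVanishing`'s quantifier order;
here `η₁, κ₁` come first and the profiles are constrained only through the guard). -/
def LocalQuadLd : Prop :=
  ∃ η₁ : ℝ, 0 < η₁ ∧ ∃ κ₁ : ℝ, 0 < κ₁ ∧ ∀ σ : ℝ, 0 < σ →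
    ∀ (a θ : ℝ → T3 → ℝ) (u : ℝ → T3 → V3),
      Continuous (Function.uncurry a) → Continuous (Function.uncurry θ) → Continuous (Function.uncurry u) →
      (∀ t x, 0 < a t x) → (∀ t x, 0 < θ t x) →
      ∀ T : ℝ, (∀ t ∈ Icc (0 : ℝ) T, ∀ x, σ ^ 3 * a t x ≤ η₁ * ∫ y, a t y) →
        ∀ (φ : ℝ → T3 → ℝ) (g : V3 → ℝ), Continuous (Function.uncurry φ) → Continuous g →
          (∀ t x, |φ t x| ≤ 1) → (∀ v, |g v| ≤ κ₁ * (1 + ‖v‖ ^ 2)) →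
          (∀ (c₀ c₂ : ℝ) (b : V3), ∫ v, g v * (c₀ + inner ℝ b v + c₂ * ‖v‖ ^ 2) ∂(ProbabilityTheory.stdGaussian V3) = 0) →
          ∀ δ : ℝ, 0 < δ → ∃ τ : ℝ, 0 < τ ∧ ∃ N₀ : ℕ, ∀ N : ℕ, N₀ ≤ N → ∀ t ∈ Icc (0 : ℝ) T,
            ∀ Φ : HardSphereFlow (Torus.geometry (Fin 3)) (hsDiameter σ N) (N + 1),
              ∫⁻ z, ENNReal.ofReal (Real.exp ((τ * ((N + 1 : ℕ) : ℝ) ^ (-(1 / 3 : ℝ)))⁻¹ *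
                  ∫ s in (0 : ℝ)..(τ * ((N + 1 : ℕ) : ℝ) ^ (-(1 / 3 : ℝ))),
                    ∑ i, φ t (Φ.flow s z i).1 *
                      g ((Real.sqrt (θ t (Φ.flow s z i).1))⁻¹ • ((Φ.flow s z i).2 - u t (Φ.flow s z i).1))))
                ∂(localGibbsLaw σ (a t) (u t) (θ t) N Φ) ≤
              ENNReal.ofReal (Real.exp (δ * (N + 1)))

/-- **The velocity-tail child, exactly the catalogued open hypothesis** (= ideator 3's `GaussianTailsAlongEvolution`):
Nachtergaele–Yau's Gaussian moment bound along the TRUE evolution, `Literature.Barriers.AtomisticToContinuum.HighMomentumCutoff σ`,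
for all small `σ` — consumed by the ledger through Chebyshev, never through the entropy inequality (Disproof §4; BN2). -/
def GaussianTailsAlongEvolution : Prop :=
  ∃ σ₀ : ℝ, 0 < σ₀ ∧ ∀ σ : ℝ, 0 < σ → σ < σ₀ → Literature.Barriers.AtomisticToContinuum.HighMomentumCutoff σ

/-! ## §2 The six stub STATEMENTS, named (the hypotheses of the composition) -/

/-- **S1 statement — the crux's TYPING GAP, isolated (NOT this line's lever).**  From the hypothesis AS TYPED (bounded
class `|g| ≤ κ`, `κ` after `σ`) to the quadratic-growth class with `κ` before `σ` (`typed_of_quad` is the converse). -/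
def AmplitudeUpgrade : Prop := KineticFluxLdDecay → KineticFluxLdDecayQuad

/-- **S2 statement — THE LEVER**: homogeneous quadratic-class hypothesis + short-window locality ⟹ the localised window
pressure. -/
def BlockPeriodisation : Prop := KineticFluxLdDecayQuad → ShortWindowInfluenceLocality → LocalQuadLd

/-- **S3 statement — the kinetic-window relative-entropy LEDGER**: localised window pressure + the GIVEN children of 9282
(collisional twin and true-law cell guards 9518 ∧ 9519, Gaussian velocity tails along the true law, dilute statics
9246 ∧ 0768, dilute guard 3091) ⟹ the TIED target. -/
def WindowGronwall : Prop :=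
  LocalQuadLd →
    (CollisionIsometryCLT.CollisionalTransferLocality ∧ CollisionIsometryCLT.AprioriBounds) →
    GaussianTailsAlongEvolution →
    (FluxGibbsianityLdDrude.LocalGibbsConcentration ∧ FluxGibbsianityLdDrude.HsEosLowDensity) →
    CollisionIsometryCLT.DiluteSelfConsistency →
    RelEntropyVanishing

/-- **S4 statement — the GIVEN children of 9282 under the TRUE law** (items 9518 ∧ 9519 of CollisionIsometryCLT; the
catalogued open hypothesis `HighMomentumCutoff σ` for small `σ`). -/
def TrueLawInputs : Prop :=
  (CollisionIsometryCLT.CollisionalTransferLocality ∧ CollisionIsometryCLT.AprioriBounds) ∧ GaussianTailsAlongEvolution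

/-- **S5 statement — the GIVEN static and PDE children of 9282** (items 9246 = 0767 and 0768 of FluxGibbsianityLdDrude;
3091 the dilute guard). -/
def StaticAndPdeInputs : Prop :=
  (FluxGibbsianityLdDrude.LocalGibbsConcentration ∧ FluxGibbsianityLdDrude.HsEosLowDensity) ∧
    CollisionIsometryCLT.DiluteSelfConsistency

/-! ## §3 Registered stubs (`sorry` lives ONLY here) -/

/-- **S1 · stub_amplitudeUpgrade — the crux's TYPING GAP, isolated (NOT this line's lever).**  Why it is here: triage X2 /
BN1 (kit j009569, j009621; envelope inf ≈ 1 at `T c_θ = 1, κ = 0.5`) — no entropy-inequality ledger closes the heat-flux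
step from the bounded class (rate `c_θA³/2κ` vs at best Gaussian tails), while the quadratic class closes à la NY; BN3 /
S2 — blockwise consumption of the hypothesis on the continuum `σρ̂^{1/3}` needs `inf κ > 0` on the density band.  Status:
TRUE as an implication iff the quadratic-class statement is true (believed: the Donsker–Varadhan tilt floor is quadratic and
σ-independent); no derivation from A by truncation/convexity (BN1(e)); mechanisms on the board: (i) tenure re-types 10967
(then this stub is `fun h => h` up to `κ(1+‖v‖²) ≥ κ`), (ii) `rare-band-residence-ladder` (RareBandSlaving +
AmplitudeLadder: bounded ∧ rare ⇒ quadratic) + a κ-uniformity lemma.  Size: open-problem-grade as an implication. -/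
theorem stub_amplitudeUpgrade : AmplitudeUpgrade := by
  sorry

/-- **S2a · stub_shortWindowLocality — the line's one dynamical lemma** (`ShortWindowInfluenceLocality`, docstring above).
Size L: chain counting under the INVARIANT homogeneous law (stationarity available: Maxwellian velocities at every time,
hard-core packing bounds the number of spheres in a ball deterministically); the three influence mechanisms (fast carrier,
Newton-cradle chain, near-jammed cluster) each have cost per corrupted forecast → ∞ as `N → ∞` at fixed `(τ, R₀)`. -/
theorem stub_shortWindowLocality : ShortWindowInfluenceLocality := by
  sorry

/-- **S2 · stub_blockPeriodisation — THE LEVER (card steps (1)–(3), sharpened by triage).**  From the homogeneous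
quadratic-class hypothesis and short-window locality to the localised window pressure `LocalQuadLd`.  Named pieces:
(i) h-prefactor is NOT used here (it lives in S3) — this stub is a pure per-window-start statement; (ii) block-freeze the
profiles to cubes of macroscopic side `r` (Rényi-2 cost `O(N r² ‖∇(log a, u, θ)‖²)`, first order cancels: triage r1-1/3);
(iii) locality: replace the window functional by the sum of PERIODISED-BLOCK functionals, the bad set (particles within
`R₀ = ηr` of a block face influenced across the collar, plus the `O(h/r)`-layer) being superexponentially rare under ONE hot
invariant law by S2a and `ψ ≤ e^{KN} G_hot` POINTWISE (`θ_hot > sup θ`; triage r1-3: no reference is transported, so the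
contrast-limited `L^p` quasi-invariance of the patchwork reference is not needed); (iv) 27-colour chessboard Hölder
(amplitude × 27, free) + EXACT conditional independence of same-colour blocks under the grand-canonical hard-core law
(finite range `ε_N ≪ r`), canonical → grand-canonical `e^{o(N)}` for upper bounds; (v) per block: thin the `ε_N`-collar
(`≤ 6σρ̂^{1/3} n_b^{2/3} = o(n_b)` centres), periodise on a torus of side `r' ∈ [r, (1+η)r]` chosen so that the reduced
parameter `σ' = ε_N n_b^{1/3}/r'` lies on a FINITE geometric net (side-rounding: the empty slack region is un-conditioned
at STATIC cost `e^{Cηn_b}`, collar comparison `e^{±o(n_b)}` uniform in the exterior), blow up by `1/r'`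
(`hsDiameter_block`): the block IS the hypothesis' system at `(n_b, σ'_j)` in the frame `(u_b, θ_b)`, mapped to the
standard frame by exact Galilean/thermal covariance (moving test function costs `e^{(n_b)κω_φ(|u|h)} = e^{o(n_b)}`), with a
common window by upward stability `Λ_{kτ+r} ≤ Λ_τ kτ/(kτ+r) + κr/(kτ+r)`; blocks with `n_b < N₀` contribute `e^{O(m³)}`;
(vi) the quadratic class through the locality error: kinetic energy carried by the bad set is LD-small (static Gaussian
cost in a layer of vanishing volume fraction, under the invariant comparison laws).  The density guard of `LocalQuadLd`
puts every `σ'_j(1+η)` below the hypothesis' `σ₀`; `κ₁ := κ/(27·8)`, `η₁ := (σ₀/2)³ e^{-Cη₁}`.  Size L–XL, all tools named. -/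
theorem stub_blockPeriodisation : BlockPeriodisation := by
  sorry

/-- **S3 · stub_windowGronwall — the kinetic-window relative-entropy LEDGER (shared by every line of this crux).**
Bookkeeping (Disproof §5.5 `discreteWindowGronwall_exp`; KipnisLandim1999 Ch. 6 pp. 120–134; NachtergaeleYau2003 §5
Lemma 5.1, §7 Thm 7.1): for deterministic dynamics `H(f_t|ψ_t) = −E_{f₀}[log ψ_t(Φ_t z) − log ψ₀(z)]` with `H(f₀|ψ₀) = 0`
(TIE, Disproof §2); along the flow `d log ψ_s = Σ_i(∂_sλ + v_i·∇λ)·ζ_i ds + (collisional transfer) − d log Z_s`; the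
conserved-field part cancels against the Euler equations for `λ` (Disproof §3; affine-projection identity of card
isentropic-affine-skeleton, triage: harvest as a free sub-lemma); the fast kinetic part is fed window by window to
`LocalQuadLd` at amplitude `γ ≍ κ₁/(‖∇λ‖A)` for the `A`-truncated, re-orthogonalised heat flux and stress (rate `∝ A`);
the collisional transfer is the Irving–Kirkwood residual of 9518 (a local function `p_c(ρ̄, θ̄)` of mesoscopic block fields
+ `o(1)` in probability; L¹ via energy conservation + the tails; quadratic EOS remainder by the entropy inequality with the
static block LD of 9246-type statics; `p_c = ρθ(Z(ρσ³) − 1)` `C²` by 0768); tails `|w|³ 1_{|w|>A}` in EXPECTATION by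
`HighMomentumCutoff` + Chebyshev (`≤ C e^{-cA²/2}`, beats `e^{CAT}`: NY §7.2; or Osgood with `A := c⁻¹ log(N/H)`, BN4);
3091 keeps `ρσ³ < η₁/4` along the tied solution so the guard of `LocalQuadLd` holds for the matched activities `a_t`
(activity ↔ density inversion in the dilute band: same cluster expansion as 9246); `σ₀^B := min(σ₀(3091, η₁/4),
σ₀(tails), σ₁(LLN), 1/2)`; B's clause (i) by `isProbabilityMeasure_localGibbsLaw`, clause (ii) by 9246 at `(a_t, u_t, θ_t)`
in dilute-UNIFORM form (σ₀ depending only on the reduced-density bound — the prover files that variant `--supports`),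
clause (iii) = the Gronwall output `H(t)/(N+1) → 0`.  KNOWN SOFT SPOT (flagged for the lead): 9518/9519 are typed in
probability; the ledger needs the collisional replacement in L¹ — uniform integrability of `p_c(ρ̄,θ̄)` on jammed cells is
not automatic (restating 9518 in expectation is the repair if needed).  Size XL, made of named pieces. -/
theorem stub_windowGronwall : WindowGronwall := by
  sorry

/-- **S4 · stub_trueLawInputs — the GIVEN children of 9282 that live under the TRUE law** (other items on the board, not
this line's): the collisional twin in its typed form `CollisionalTransferLocality` (stmt-9518: the line-averaged collisional
momentum/energy transfer, defined as the Irving–Kirkwood residual, is `p_c(ρ̄, θ̄)`-local in probability) ∧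
`AprioriBounds` (stmt-9519: time-averaged one-particle Gaussian velocity moment + no empty / no jammed mesoscopic cell, in
probability), and `GaussianTailsAlongEvolution` (the catalogued `HighMomentumCutoff σ` for small `σ`, NachtergaeleYau2003
Assumption II.1, "no proof even in the classical case").  Open; the activity-tail sub-input is the target of the sibling
crux idea `explosion-limited-jamming`. -/
theorem stub_trueLawInputs : TrueLawInputs := by
  sorry

/-- **S5 · stub_staticAndPdeInputs — the GIVEN static and PDE children of 9282** (other items on the board):
`LocalGibbsConcentration` (stmt-9246 = 0767, exponential LLN of canonical local Gibbs states at small reduced density,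
low-density cluster expansion, M) ∧ `HsEosLowDensity` (stmt-0768, Ruelle1969 §3.4 + LebowitzPenrose1964: analytic excess
free energy, `Z = 1 + (2π/3)η + O(η²)`, M) ∧ `DiluteSelfConsistency` (stmt-3091, the dilute guard: tied classical hs-Euler
solutions stay at reduced density `< η` for `σ < σ₀(η, profiles)`; open-problem-grade, refuted iff
`ImplosionDichotomy.DenseExcursion` holds — the board-known quantifier price of 9282 itself, triage X3 / N4). -/
theorem stub_staticAndPdeInputs : StaticAndPdeInputs := by
  sorry

/-! ### Consistency: each named statement IS its registered stub -/

theorem amplitudeUpgrade_holds : AmplitudeUpgrade := stub_amplitudeUpgrade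
theorem shortWindowLocality_holds : ShortWindowInfluenceLocality := stub_shortWindowLocality
theorem blockPeriodisation_holds : BlockPeriodisation := stub_blockPeriodisation
theorem windowGronwall_holds : WindowGronwall := stub_windowGronwall
theorem trueLawInputs_holds : TrueLawInputs := stub_trueLawInputs
theorem staticAndPdeInputs_holds : StaticAndPdeInputs := stub_staticAndPdeInputs

/-! ### Name-keyed aliases of the six statements (the hypotheses of the composition; the skeleton audit admits a
hypothesis only if its head constant is a registered obligation or is named like a declared stub) -/
namespace Registered

/-- Alias of `AmplitudeUpgrade` keyed by the registered stub name. -/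
abbrev stub_amplitudeUpgrade : Prop := AmplitudeUpgrade
/-- Alias of `ShortWindowInfluenceLocality` keyed by the registered stub name. -/
abbrev stub_shortWindowLocality : Prop := ShortWindowInfluenceLocality
/-- Alias of `BlockPeriodisation` keyed by the registered stub name. -/
abbrev stub_blockPeriodisation : Prop := BlockPeriodisation
/-- Alias of `WindowGronwall` keyed by the registered stub name. -/
abbrev stub_windowGronwall : Prop := WindowGronwall
/-- Alias of `TrueLawInputs` keyed by the registered stub name. -/
abbrev stub_trueLawInputs : Prop := TrueLawInputs
/-- Alias of `StaticAndPdeInputs` keyed by the registered stub name. -/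
abbrev stub_staticAndPdeInputs : Prop := StaticAndPdeInputs

end Registered

/-! ## §3b The kernel-checked composition -/

/-- **The line concludes the crux BY NAME** (primary route AntiMazurCoboundaries): the six registered stub statements
imply `Summit.AtomisticToContinuum.HydrodynamicLimit.Theses.AntiMazurCoboundaries.KineticWindowGronwall` — pure logic:
upgrade the hypothesis (S1), localise it (S2 with S2a), run the ledger (S3) on the GIVEN children (S4, S5). -/
theorem KineticWindowGronwall_of (h₁ : Registered.stub_amplitudeUpgrade) (h₂ : Registered.stub_shortWindowLocality)
    (h₃ : Registered.stub_blockPeriodisation) (h₄ : Registered.stub_windowGronwall)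
    (h₅ : Registered.stub_trueLawInputs) (h₆ : Registered.stub_staticAndPdeInputs) :
    Summit.AtomisticToContinuum.HydrodynamicLimit.Theses.AntiMazurCoboundaries.KineticWindowGronwall :=
  fun hA => h₄ (h₃ (h₁ hA) h₂) h₅.1 h₅.2 h₆.1 h₆.2

/-- **The same composition for the sibling route's decl** (shared item 9282; `rfl`-equal decls): the six registered stub
statements imply `Summit.AtomisticToContinuum.HydrodynamicLimit.Theses.FluxGibbsianityLdDrude.KineticWindowGronwall`. -/
theorem KineticWindowGronwall_of_sibling (h₁ : Registered.stub_amplitudeUpgrade)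
    (h₂ : Registered.stub_shortWindowLocality) (h₃ : Registered.stub_blockPeriodisation)
    (h₄ : Registered.stub_windowGronwall) (h₅ : Registered.stub_trueLawInputs)
    (h₆ : Registered.stub_staticAndPdeInputs) :
    Summit.AtomisticToContinuum.HydrodynamicLimit.Theses.FluxGibbsianityLdDrude.KineticWindowGronwall :=
  fun hA => h₄ (h₃ (h₁ hA) h₂) h₅.1 h₅.2 h₆.1 h₆.2

/-- Wiring check: the registered stubs themselves feed the composition as stated (depends on their `sorry`s only). -/
example : KineticWindowGronwall :=
  KineticWindowGronwall_of stub_amplitudeUpgrade stub_shortWindowLocality stub_blockPeriodisation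
    stub_windowGronwall stub_trueLawInputs stub_staticAndPdeInputs

/-! ## §4 Disproof honoured (checked against the stub set)

The landed Negative lemmas of this crux (`Theorems/KineticWindowGronwall/Negative/ConsequentLoadBearing.lean`, p74367:
`KineticWindowGronwallNegative.crux_untied_false_of_antecedent`, `crux_noPDE_false_of_antecedent`; `CubicMomentDiverges.lean`,
p73911: `lintegral_exp_mul_pow_three_eq_top`) are honoured as follows (they are not imported here only because the farm build
of those two modules was stale at publication time — `lean check` rc 75 `remote:stale:unbuilt` —; the planner folder keeps
`line-full-with-negatives.lean`, byte-identical plus those two imports and the three `example`s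
`crux_untied_false_of_antecedent hA`, `crux_noPDE_false_of_antecedent hA`, `lintegral_exp_mul_pow_three_eq_top hα`,
to be re-checked by the lead once the build is current):
* §2 tie — `stub_windowGronwall` concludes the TIED `RelEntropyVanishing` (Gronwall from `H(f₀|ψ₀) = 0`);
* §3 balance laws — consumed in the ledger's conserved-field cancellation and in 3091's hypothesis `IsHardSphereEulerSolution`;
* §4 cubic moments — nothing cubic is exponentiated: every LD statement of the line is quadratic-class (finite, first
  `example` below), the cubic tail enters only in expectation through `GaussianTailsAlongEvolution`; the barrier's own form of
  the divergence is the second `example`. -/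

/-- The quadratic class is the maximal Maxwellian-integrable one (barrier file, proved): for `c < 1/(2θ)` the Gaussian
quadratic exponential moment is finite — `KineticFluxLdDecayQuad` / `LocalQuadLd` have finite moments for each `N`. -/
example {θ c : ℝ} (hc : c < 1 / (2 * θ)) :
    ∫⁻ p : V3, ENNReal.ofReal (Real.exp (c * ‖p‖ ^ 2 - ‖p‖ ^ 2 / (2 * θ))) < ∞ :=
  Literature.Barriers.AtomisticToContinuum.lintegral_exp_quadratic_lt_top hc

/-- Disproof §4 in the barrier's form (proved in the tree): the convective energy current has NO exponential moment under a
Maxwellian beyond any cut-off level — the reason the tail child is an a-priori estimate under the TRUE law. -/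
example {θ γ : ℝ} (hθ : 0 < θ) (hγ : 0 < γ) (M : ℝ) :
    ∫⁻ p in {p : V3 | M < ‖p‖}, ENNReal.ofReal (Real.exp (γ * ‖p‖ ^ 3 - ‖p‖ ^ 2 / (2 * θ))) = ∞ :=
  Literature.Barriers.AtomisticToContinuum.setLIntegral_exp_cubic_eq_top hθ hγ M

end Summit.AtomisticToContinuum.HydrodynamicLimit.Cruxes.KineticWindowGronwall.SelfSimilarBlockPeriodisation

end
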